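import Mathlib
import HarnessLib
import Summits.Ventures.LatticeQCDFlow.Exactness.RejectionSamplingCap

/-!
# The capped rejection loop IS a mixture: `cappedLaw = (1 − r^M)·loopLaw + r^M·δ_default` — the exact draw with probability `1 − r^M`

HONEST FRAMING: exact (Metropolis-corrected) sampling algorithms for lattice gauge theory;
figures of merit are autocorrelation/cost numbers at stated couplings and volumes; no
continuum-physics claim.

Venture `LatticeQCDFlow` (cell pub-lqcd), topic `Exactness`, FANOUT row 9 (eng-latcore, the engine's
capped rejection loops `for (it = 0; it < M; it++) {…} return x₀;` — `sample_a0`: `M = 10⁴` Kennedy–Pendleton,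
`10⁵` Creutz, default `a₀ = 1`; `rng_vmf_w`: `M = 10⁶`).  NEW WORK of the cell over the tree's
`RejectionSamplingCap.lean` (`cappedLaw`, `cappedLaw_apply`, the one-sided bounds
`cappedLaw_le_loopLaw_add` / `loopLaw_le_cappedLaw_add` in `ℝ≥0∞`) and `RejectionSampling.lean` (`loopLaw_apply`,
`one_sub_reject`, `loopLaw_thinning`, `thinning_accept`); nothing is cited as a fact; no number is claimed.
What is added: the capped law is IDENTIFIED as a two-point mixture (not only bounded), in the form the
link-level statement `SU2HeatBathCapped.lean` pushes through the axis chart and the quaternion assembly,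
with the real-valued total-variation reading and the thinning instance.

* **`abs_real_sub_le_of_eq_mixture`** — generic: for probability laws `ν, ξ` and `q ≤ 1`,
  `μ = (1 − q)•ν + q•ξ ⇒ |μ(A) − ν(A)| ≤ q` for every set `A` (real-valued).
* `geom_sum_mul_one_sub` — `(Σ_{n<M} rⁿ)(1 − r) = 1 − r^M` in `ℝ≥0∞` (`r ≤ 1`).
* **`cappedLaw_eq_mixture`** — if a round accepts with positive probability:
  `cappedLaw ρ M x₀ = (1 − r^M) • loopLaw ρ + r^M • δ_{x₀}`, `r = ρ(reject)`: the capped draw IS the exact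
  draw (`loopLaw ρ`, `RejectionSampling.loopLaw_eq`) with probability `1 − r^M` and the default otherwise.
* **`abs_cappedLaw_real_sub_loopLaw_le`** — `|cappedLaw(A) − loopLaw(A)| ≤ r^M` for EVERY set `A` (real
  numbers; the tree's bounds are the two `ℝ≥0∞` inequalities on measurable sets).
* `cappedLaw_thinning_eq_mixture`, `abs_cappedLaw_thinning_sub_le` — the thinning round (propose `x ∼ q`,
  accept with probability `a x ≤ 1` — the shape of the Kennedy–Pendleton / Creutz / Wood loops):
  `r = 1 − ∫ a dq`, exact law `(∫ a dq)⁻¹ • a·q`.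

NOT CLAIMED: a numerical value of `r` for the engine's proposals; the accumulated effect over a sweep
(`KernelTVPerturbation.lean`); floating point.
-/

noncomputable section

namespace Summit.Ventures.LatticeQCDFlow.Exactness

open MeasureTheory ProbabilityTheory Set Finset
open scoped ENNReal

variable {X : Type*} [MeasurableSpace X]

/-! ## A two-component mixture is within its second weight of its first component -/

section Mixture

/-- **`(1 − q)·ν + q·ξ` is within `q` of `ν` in total variation**: for probability laws `ν, ξ` and `q ≤ 1`,
if `μ = (1 − q) • ν + q • ξ` then `|μ(A) − ν(A)| ≤ q` for every set `A`. -/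
theorem abs_real_sub_le_of_eq_mixture {μ ν ξ : Measure X} [IsProbabilityMeasure ν] [IsProbabilityMeasure ξ]
    {q : ℝ≥0∞} (hq : q ≤ 1) (h : μ = (1 - q) • ν + q • ξ) (A : Set X) :
    |μ.real A - ν.real A| ≤ q.toReal := by
  have hqtop : q ≠ ⊤ := ne_top_of_le_ne_top ENNReal.one_ne_top hq
  have h1qtop : 1 - q ≠ ⊤ := ne_top_of_le_ne_top ENNReal.one_ne_top tsub_le_self
  have hμ : μ.real A = (1 - q).toReal * ν.real A + q.toReal * ξ.real A := by
    rw [measureReal_def, h, Measure.add_apply, Measure.smul_apply, Measure.smul_apply, smul_eq_mul, smul_eq_mul,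
      ENNReal.toReal_add (ENNReal.mul_ne_top h1qtop (measure_ne_top _ _)) (ENNReal.mul_ne_top hqtop (measure_ne_top _ _)),
      ENNReal.toReal_mul, ENNReal.toReal_mul, measureReal_def, measureReal_def]
  have h1q : (1 - q).toReal = 1 - q.toReal := by
    rw [ENNReal.toReal_sub_of_le hq ENNReal.one_ne_top, ENNReal.toReal_one]
  rw [hμ, h1q]
  have hν0 : 0 ≤ ν.real A := measureReal_nonneg
  have hν1 : ν.real A ≤ 1 := measureReal_le_one
  have hξ0 : 0 ≤ ξ.real A := measureReal_nonneg
  have hξ1 : ξ.real A ≤ 1 := measureReal_le_one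
  have hq0 : 0 ≤ q.toReal := ENNReal.toReal_nonneg
  rw [show (1 - q.toReal) * ν.real A + q.toReal * ξ.real A - ν.real A = q.toReal * (ξ.real A - ν.real A) by ring,
    abs_mul, abs_of_nonneg hq0]
  exact mul_le_of_le_one_right hq0 (abs_sub_le_iff.2 ⟨by linarith, by linarith⟩)

end Mixture

/-! ## The capped loop as a mixture -/

section Cap

variable {ρ : Measure (X × Bool)} {M : ℕ} {x₀ : X}

/-- The geometric partial sum against the acceptance probability: `(Σ_{n<M} rⁿ)·(1 − r) = 1 − r^M` (`r ≤ 1`). -/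
theorem geom_sum_mul_one_sub {r : ℝ≥0∞} (hr : r ≤ 1) :
    ∀ M : ℕ, (∑ n ∈ range M, r ^ n) * (1 - r) = 1 - r ^ M
  | 0 => by simp
  | M + 1 => by
      have htop : r ^ M ≠ ⊤ := ENNReal.pow_ne_top (ne_top_of_le_ne_top ENNReal.one_ne_top hr)
      have h1 : r ^ M * (1 - r) = r ^ M - r ^ (M + 1) := by
        rw [ENNReal.mul_sub (fun _ _ => htop), mul_one, pow_succ]
      rw [sum_range_succ, add_mul, geom_sum_mul_one_sub hr M, h1]
      exact tsub_add_tsub_cancel (pow_le_one₀ zero_le hr)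
        (by rw [pow_succ]; exact mul_le_of_le_one_right zero_le hr)

/-- **THE CAPPED DRAW IS THE EXACT DRAW WITH PROBABILITY `1 − r^M` AND THE DEFAULT OTHERWISE**: if a round
accepts with positive probability, `cappedLaw ρ M x₀ = (1 − r^M) • loopLaw ρ + r^M • δ_{x₀}` with
`r = ρ(reject)` and `loopLaw ρ = ρ(accept)⁻¹ • accPart ρ` the exact normalised accepted law. -/
theorem cappedLaw_eq_mixture [IsProbabilityMeasure ρ] (h : ρ (univ ×ˢ {true}) ≠ 0) :
    cappedLaw ρ M x₀ =
      (1 - ρ (univ ×ˢ {false}) ^ M) • loopLaw ρ + ρ (univ ×ˢ {false}) ^ M • Measure.dirac x₀ := by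
  ext A hA
  rw [cappedLaw_apply hA, Measure.add_apply, Measure.smul_apply, Measure.smul_apply, smul_eq_mul,
    smul_eq_mul, loopLaw_apply hA, Measure.dirac_apply' _ hA, ← sum_mul, ← mul_assoc]
  congr 1
  congr 1
  have hgeom := geom_sum_mul_one_sub (prob_le_one (μ := ρ) (s := univ ×ˢ {false})) M
  rw [one_sub_reject] at hgeom
  rw [← div_eq_mul_inv]
  exact (ENNReal.eq_div_iff h (measure_ne_top _ _)).2 (by rw [mul_comm]; exact hgeom)

/-- **WITHIN `r^M` OF THE EXACT LAW IN TOTAL VARIATION** (real numbers, every set): `|cappedLaw(A) − loopLaw(A)|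
≤ ρ(reject)^M` whenever a round accepts with positive probability. -/
theorem abs_cappedLaw_real_sub_loopLaw_le [IsProbabilityMeasure ρ] (h : ρ (univ ×ˢ {true}) ≠ 0) (A : Set X) :
    |(cappedLaw ρ M x₀).real A - (loopLaw ρ).real A| ≤ (ρ (univ ×ˢ {false}) ^ M).toReal := by
  haveI := isProbabilityMeasure_loopLaw h
  exact abs_real_sub_le_of_eq_mixture (pow_le_one₀ zero_le prob_le_one) (cappedLaw_eq_mixture h) A

end Cap

/-! ## The thinning round: propose `x ∼ q`, accept with probability `a x` -/

section Thinning

variable {a : X → ℝ≥0∞}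

/-- **THE CAPPED THINNING LOOP AS A MIXTURE**: proposing `x ∼ q`, accepting with probability `a x ≤ 1`, at
most `M` rounds, default `x₀`; if the mean acceptance `∫ a dq` is non-zero the output law is
`(1 − (1 − ∫a dq)^M) • ((∫ a dq)⁻¹ • a·q) + (1 − ∫a dq)^M • δ_{x₀}`. -/
theorem cappedLaw_thinning_eq_mixture (q : Measure X) [IsProbabilityMeasure q] (ha : Measurable a)
    (ha1 : ∀ x, a x ≤ 1) (hpos : ∫⁻ x, a x ∂q ≠ 0) (M : ℕ) (x₀ : X) :
    cappedLaw (q ⊗ₘ coin a) M x₀ =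
      (1 - (1 - ∫⁻ x, a x ∂q) ^ M) • ((∫⁻ x, a x ∂q)⁻¹ • q.withDensity a) +
        (1 - ∫⁻ x, a x ∂q) ^ M • Measure.dirac x₀ := by
  haveI := isProbabilityMeasure_thinning q ha ha1
  have hacc : (q ⊗ₘ coin a) (univ ×ˢ {true}) = ∫⁻ x, a x ∂q := thinning_accept q ha ha1
  have hrej : (q ⊗ₘ coin a) (univ ×ˢ {false}) = 1 - ∫⁻ x, a x ∂q := by
    rw [← hacc, ← one_sub_reject (ρ := q ⊗ₘ coin a),
      ENNReal.sub_sub_cancel ENNReal.one_ne_top prob_le_one]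
  rw [cappedLaw_eq_mixture (by rwa [hacc]), loopLaw_thinning q ha ha1, hrej]

/-- **… within `(1 − ∫a dq)^M` of the exact reweighted law in total variation.** -/
theorem abs_cappedLaw_thinning_sub_le (q : Measure X) [IsProbabilityMeasure q] (ha : Measurable a)
    (ha1 : ∀ x, a x ≤ 1) (hpos : ∫⁻ x, a x ∂q ≠ 0) (M : ℕ) (x₀ : X) (A : Set X) :
    |(cappedLaw (q ⊗ₘ coin a) M x₀).real A - ((∫⁻ x, a x ∂q)⁻¹ • q.withDensity a).real A|
      ≤ ((1 - ∫⁻ x, a x ∂q) ^ M).toReal := by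
  haveI := isProbabilityMeasure_thinning q ha ha1
  have hacc : (q ⊗ₘ coin a) (univ ×ˢ {true}) = ∫⁻ x, a x ∂q := thinning_accept q ha ha1
  have hrej : (q ⊗ₘ coin a) (univ ×ˢ {false}) = 1 - ∫⁻ x, a x ∂q := by
    rw [← hacc, ← one_sub_reject (ρ := q ⊗ₘ coin a),
      ENNReal.sub_sub_cancel ENNReal.one_ne_top prob_le_one]
  have h := abs_cappedLaw_real_sub_loopLaw_le (ρ := q ⊗ₘ coin a) (M := M) (x₀ := x₀) (by rwa [hacc]) A
  rwa [loopLaw_thinning q ha ha1, hrej] at h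

end Thinning

end Summit.Ventures.LatticeQCDFlow.Exactness
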